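import Literature.NumberTheory.ComplexMultiplication.CMFieldConjSquareQuadraticSubfields
import Literature.NumberTheory.ComplexMultiplication.PartialConjugationOfRealIntersection
import HarnessLib

/-!
# Partial conjugations from a SQUARE complex conjugation: two CM fields meeting in degree `≤ 2`
# (in particular: a cyclic quartic CM field and ANY number field not containing it)

Companion of `NumberTheory/ComplexMultiplication/PartialConjugationOfRealIntersection` (for number fields `K_i` a
partial conjugation at the slot `i` — some `σ ∈ Aut(ℂ)` which is complex conjugation on `Hom(K_i, ℂ)` and the identity
on every other `Hom(K_j, ℂ)` — exists iff conjugation fixes `L_i ∩ ∏_{j≠i} L_j` pointwise, `L_i = normalClosure ℚ K_i ℂ`;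
two slots: iff it fixes `L_{i₀} ∩ L_{i₁}`) and of `…/CMFieldConjSquareQuadraticSubfields` (b23 gen 27: if complex
conjugation `conjGal` of a GALOIS CM field `K` is a SQUARE in `Gal(K/ℚ)` — e.g. `Gal(K/ℚ)` cyclic of order `≡ 0 (mod 4)`,
`isSquare_conjGal_of_isCyclic` — then a square fixes every quadratic subextension, so `K` contains no imaginary
quadratic field).  Put together:

* **`conj_apply_eq_of_isSquare_conjGal_of_finrank_le_two`** — for such a `K`, complex conjugation fixes POINTWISE every
  subfield `M ≤ normalClosure ℚ K ℂ` of degree `≤ 2` over `ℚ` (pull `M` back along the embedding; degree `1` is `ℚ`);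
* **`forall_exists_partialConj_pair_of_isSquare_conjGal`** — two slots `i₀ ≠ i₁`, `K_{i₁}` such a field and
  `[L_{i₀} ∩ L_{i₁} : ℚ] ≤ 2` ⟹ both slots carry partial conjugations (hence, downstream, `Hg(A₀ × A₁) = Hg(A₀) × Hg(A₁)`
  and the Hodge conjecture for `A₀^a × A₁^b` with nondegenerate types: `Summits/…/SmallIntersectionCMFieldsHodge`);
* **`finrank_inf_le_two_of_finrank_eq_four`** — `[L₀ ∩ L₁ : ℚ] ≤ 2` is automatic when `[L₁ : ℚ] = 4` and `L₁ ⊄ L₀`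
  (a proper divisor of `4`); `not_le_of_finrank_eq_four_of_not_dvd` — `L₁ ⊄ L₀` is automatic when `4 ∤ [L₀ : ℚ]`;
* **`forall_exists_partialConj_pair_of_cyclic_quartic`** — `K_{i₁}` a CYCLIC QUARTIC CM field (Galois, cyclic group,
  degree `4`: its conjugation is a square and its only quadratic subfield is real) and ANY number field `K_{i₀}` whose Galois
  closure does not contain `L_{i₁}`; variants `…_of_ne` (both `K_i` Galois quartic with `L_{i₀} ≠ L_{i₁}`) and
  `…_of_not_dvd` (`4 ∤ [L_{i₀} : ℚ]`, e.g. `K_{i₀}` a cyclic sextic or any CM field of degree `2·odd` with Galois closure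
  of degree prime to `4`… more precisely not divisible by `4`).

Everything is proved; theorems only, no definition, no named fact, no `sorry`.

## References

* [Lang2002] S. Lang, *Algebra*, 3rd ed., GTM 211, VI §1 Cor. 1.4 (index-`2` subgroups contain all squares; Galois
  correspondence), V §3 Thm. 3.3.
* [Shimura1998] G. Shimura, *Abelian Varieties with Complex Multiplication and Modular Functions*, §8.4 Example (2)(B)
  (cyclic quartic CM fields: every CM type primitive), §18.2 Lemma (i).
* [Gordon1999HodgeAVSurvey] B. B. Gordon, *A survey of the Hodge conjecture for abelian varieties*, §3 Theorem (proof).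
-/

noncomputable section

open IntermediateField Module NumberField

namespace Literature.NumberTheory.ComplexMultiplication

/-! ### A square conjugation fixes every subfield of degree `≤ 2` of the Galois closure -/

section Square

variable {K : Type} [Field K] [NumberField K] [IsCMField K]

/-- **If `conjGal` is a square in `Gal(K/ℚ)` (Galois CM field `K`), complex conjugation fixes pointwise every subfield
`M` of `normalClosure ℚ K ℂ` with `[M : ℚ] ≤ 2`**: `M = ℚ`, or `M` pulls back along the embedding `s` (`L = s(K)` for a
normal `K`) to a quadratic subextension of `K`, fixed pointwise by the square `conjGal`, and `s ∘ conjGal = conj ∘ s`.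
[cite: Lang2002, VI §1 Cor. 1.4] -/
theorem conj_apply_eq_of_isSquare_conjGal_of_finrank_le_two [IsGalois ℚ K] (hsq : IsSquare (conjGal : K ≃ₐ[ℚ] K))
    (M : IntermediateField ℚ ℂ) [FiniteDimensional ℚ M] (hM : M ≤ normalClosure ℚ K ℂ)
    (h2 : finrank ℚ M ≤ 2) {x : ℂ} (hx : x ∈ M) : starRingEnd ℂ x = x := by
  obtain ⟨s⟩ : Nonempty (K →ₐ[ℚ] ℂ) :=
    ⟨(Classical.choice (inferInstance : Nonempty (K →+* ℂ))).toRatAlgHom⟩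
  rw [normalClosure_eq_fieldRange_of_normal s] at hM
  have hpos : 0 < finrank ℚ M := finrank_pos
  by_cases h1 : finrank ℚ M = 1
  · -- `M = ℚ`
    have hbot : M = ⊥ := IntermediateField.finrank_eq_one_iff.1 h1
    rw [hbot, IntermediateField.mem_bot] at hx
    obtain ⟨q, rfl⟩ := hx
    rw [eq_ratCast]
    exact map_ratCast (starRingEnd ℂ) q
  · -- `[M : ℚ] = 2`: pull back to a quadratic subextension of `K`
    have h2' : finrank ℚ M = 2 := by omega
    set M' : IntermediateField ℚ K := M.comap s with hM'
    have hmap : M'.map s = M := IntermediateField.map_comap_eq_self hM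
    have hfin : finrank ℚ M' = 2 := by
      rw [← h2', (IntermediateField.equivMap M' s).toLinearEquiv.finrank_eq, hmap]
    have hxM : x ∈ M'.map s := by rw [hmap]; exact hx
    obtain ⟨m, hm, rfl⟩ := (IntermediateField.mem_map (S := M') (f := s) (y := x)).1 hxM
    rw [← algHom_conjGal_apply s m, apply_eq_self_of_isSquare_of_finrank_eq_two M' hfin hsq hm]

end Square

/-! ### Degree bookkeeping: intersections with a quartic field -/

section Degree

/-- A subfield of a finite extension (inside `ℂ`) is finite. [folklore] -/
private theorem finiteDimensional_of_le'' {E E' : IntermediateField ℚ ℂ} [FiniteDimensional ℚ E] (h : E' ≤ E) :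
    FiniteDimensional ℚ E' :=
  FiniteDimensional.of_injective (IntermediateField.inclusion h).toLinearMap (IntermediateField.inclusion_injective h)

/-- **`[L₀ ∩ L₁ : ℚ] ≤ 2` when `[L₁ : ℚ] = 4` and `L₁ ⊄ L₀`**: the degree of `L₀ ∩ L₁` divides `4` and is not `4`
(else `L₀ ∩ L₁ = L₁`, i.e. `L₁ ≤ L₀`). [cite: Lang2002, VI §1 Cor. 1.4] -/
theorem finrank_inf_le_two_of_finrank_eq_four (L₀ L₁ : IntermediateField ℚ ℂ) [FiniteDimensional ℚ L₁]
    (h4 : finrank ℚ L₁ = 4) (hnle : ¬ L₁ ≤ L₀) : finrank ℚ ↥(L₀ ⊓ L₁) ≤ 2 := by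
  haveI : FiniteDimensional ℚ ↥(L₀ ⊓ L₁) := finiteDimensional_of_le'' inf_le_right
  have hdvd : finrank ℚ ↥(L₀ ⊓ L₁) ∣ 4 := h4 ▸ IntermediateField.finrank_dvd_of_le_right (inf_le_right : L₀ ⊓ L₁ ≤ L₁)
  have hne : finrank ℚ ↥(L₀ ⊓ L₁) ≠ 4 := by
    intro h
    apply hnle
    have heq : L₀ ⊓ L₁ = L₁ := IntermediateField.eq_of_le_of_finrank_eq inf_le_right (by rw [h, h4])
    exact heq ▸ inf_le_left
  have hle : finrank ℚ ↥(L₀ ⊓ L₁) ≤ 4 := Nat.le_of_dvd (by norm_num) hdvd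
  interval_cases h : finrank ℚ ↥(L₀ ⊓ L₁) <;> simp_all

/-- `L₁ ⊄ L₀` when `[L₁ : ℚ] = 4` does not divide `[L₀ : ℚ]` (degrees are multiplicative in towers).
[cite: Lang2002, VI §1 Cor. 1.4] -/
theorem not_le_of_finrank_eq_four_of_not_dvd (L₀ L₁ : IntermediateField ℚ ℂ) [FiniteDimensional ℚ L₀]
    (h4 : finrank ℚ L₁ = 4) (hndvd : ¬ 4 ∣ finrank ℚ L₀) : ¬ L₁ ≤ L₀ := fun hle =>
  hndvd (h4 ▸ IntermediateField.finrank_dvd_of_le_right hle)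

end Degree

/-! ### Two slots: a field with square conjugation and a field meeting it in degree `≤ 2` -/

section Pair

variable {I : Type} {K : I → Type} [∀ i, Field (K i)] [∀ i, NumberField (K i)]

/-- **Two slots, square conjugation, small intersection.**  If `K_{i₁}` is a Galois CM field whose complex conjugation
is a square in `Gal(K_{i₁}/ℚ)` and `[L_{i₀} ∩ L_{i₁} : ℚ] ≤ 2` (`L_i` the Galois closures in `ℂ`), then conjugation fixes
`L_{i₀} ∩ L_{i₁}` pointwise, so both slots carry partial conjugations (Gordon's `σ` for the pair).
[cite: Gordon1999HodgeAVSurvey, §3 Theorem (proof)] -/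
theorem forall_exists_partialConj_pair_of_isSquare_conjGal [Finite I] {i₀ i₁ : I} (h01 : i₀ ≠ i₁)
    (hI : ∀ j, j = i₀ ∨ j = i₁) [IsCMField (K i₁)] [IsGalois ℚ (K i₁)]
    (hsq : IsSquare (conjGal : K i₁ ≃ₐ[ℚ] K i₁))
    (h2 : finrank ℚ ↥(normalClosure ℚ (K i₀) ℂ ⊓ normalClosure ℚ (K i₁) ℂ) ≤ 2) :
    ∀ i : I, ∃ σ : ℂ ≃+* ℂ, (∀ s : K i →+* ℂ, σ • s = (starRingAut : ℂ ≃+* ℂ) • s) ∧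
      ∀ j, j ≠ i → ∀ s : K j →+* ℂ, σ • s = s := by
  haveI : FiniteDimensional ℚ ↥(normalClosure ℚ (K i₀) ℂ ⊓ normalClosure ℚ (K i₁) ℂ) :=
    finiteDimensional_of_le'' inf_le_right
  exact forall_exists_partialConj_pair h01 hI fun x h₀ h₁ =>
    conj_apply_eq_of_isSquare_conjGal_of_finrank_le_two hsq _ inf_le_right h2 ⟨h₀, h₁⟩

/-- **A cyclic quartic CM field and any number field not containing it.**  Let `K_{i₁}` be a CYCLIC QUARTIC CM field
(Galois over `ℚ` with cyclic group, degree `4`: `conjGal = σ²` is a square, `isSquare_conjGal_of_isCyclic`) and `K_{i₀}`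
any number field whose Galois closure `L_{i₀}` does not contain `L_{i₁}`.  Then `[L_{i₀} ∩ L_{i₁} : ℚ] ≤ 2` — the
intersection is `ℚ` or the REAL quadratic subfield of `K_{i₁}` — and both slots carry partial conjugations.
[cite: Shimura1998, §8.4 Example (2)(B)] -/
theorem forall_exists_partialConj_pair_of_cyclic_quartic [Finite I] {i₀ i₁ : I} (h01 : i₀ ≠ i₁)
    (hI : ∀ j, j = i₀ ∨ j = i₁) [IsCMField (K i₁)] [IsGalois ℚ (K i₁)] [IsCyclic (K i₁ ≃ₐ[ℚ] K i₁)]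
    (h4 : finrank ℚ (K i₁) = 4) (hnle : ¬ normalClosure ℚ (K i₁) ℂ ≤ normalClosure ℚ (K i₀) ℂ) :
    ∀ i : I, ∃ σ : ℂ ≃+* ℂ, (∀ s : K i →+* ℂ, σ • s = (starRingAut : ℂ ≃+* ℂ) • s) ∧
      ∀ j, j ≠ i → ∀ s : K j →+* ℂ, σ • s = s :=
  forall_exists_partialConj_pair_of_isSquare_conjGal h01 hI (isSquare_conjGal_of_isCyclic (by rw [h4]))
    (finrank_inf_le_two_of_finrank_eq_four _ _ ((finrank_normalClosure_of_normal (K := K i₁)).trans h4) hnle)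

/-- **Two NON-ISOMORPHIC cyclic quartic CM fields** (more generally: `K_{i₁}` cyclic quartic CM, `K_{i₀}` Galois quartic,
with different Galois closures in `ℂ`): both slots carry partial conjugations — they meet in `ℚ` or in their common
real quadratic subfield (e.g. `ℚ(ζ_5)` and `ℚ(√5, √(−(5+√5)))`, meeting in `ℚ(√5)`). [cite: Shimura1998, §8.4 Example (2)(B)] -/
theorem forall_exists_partialConj_pair_of_cyclic_quartic_of_ne [Finite I] {i₀ i₁ : I} (h01 : i₀ ≠ i₁)
    (hI : ∀ j, j = i₀ ∨ j = i₁) [IsGalois ℚ (K i₀)] [IsCMField (K i₁)] [IsGalois ℚ (K i₁)]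
    [IsCyclic (K i₁ ≃ₐ[ℚ] K i₁)] (h4₀ : finrank ℚ (K i₀) = 4) (h4 : finrank ℚ (K i₁) = 4)
    (hne : normalClosure ℚ (K i₀) ℂ ≠ normalClosure ℚ (K i₁) ℂ) :
    ∀ i : I, ∃ σ : ℂ ≃+* ℂ, (∀ s : K i →+* ℂ, σ • s = (starRingAut : ℂ ≃+* ℂ) • s) ∧
      ∀ j, j ≠ i → ∀ s : K j →+* ℂ, σ • s = s := by
  refine forall_exists_partialConj_pair_of_cyclic_quartic h01 hI h4 fun hle => hne ?_
  exact (IntermediateField.eq_of_le_of_finrank_eq hle (by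
    rw [(finrank_normalClosure_of_normal (K := K i₀)).trans h4₀,
      (finrank_normalClosure_of_normal (K := K i₁)).trans h4])).symm

/-- **A cyclic quartic CM field and a number field whose Galois closure has degree not divisible by `4`** (e.g. a
cyclic sextic CM field, an `S₃`-cubic times an imaginary quadratic, …): both slots carry partial conjugations.
[cite: Shimura1998, §8.4 Example (2)(B)] -/
theorem forall_exists_partialConj_pair_of_cyclic_quartic_of_not_dvd [Finite I] {i₀ i₁ : I} (h01 : i₀ ≠ i₁)
    (hI : ∀ j, j = i₀ ∨ j = i₁) [IsCMField (K i₁)] [IsGalois ℚ (K i₁)] [IsCyclic (K i₁ ≃ₐ[ℚ] K i₁)]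
    (h4 : finrank ℚ (K i₁) = 4) (hndvd : ¬ 4 ∣ finrank ℚ (normalClosure ℚ (K i₀) ℂ)) :
    ∀ i : I, ∃ σ : ℂ ≃+* ℂ, (∀ s : K i →+* ℂ, σ • s = (starRingAut : ℂ ≃+* ℂ) • s) ∧
      ∀ j, j ≠ i → ∀ s : K j →+* ℂ, σ • s = s :=
  forall_exists_partialConj_pair_of_cyclic_quartic h01 hI h4
    (not_le_of_finrank_eq_four_of_not_dvd _ _ ((finrank_normalClosure_of_normal (K := K i₁)).trans h4) hndvd)

end Pair

end Literature.NumberTheory.ComplexMultiplication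

end
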